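import Summits.QuantumFields.YangMills.Theorems.BalabanUVNodesN15VectorPieceBackward
import HarnessLib

/-!
# Route «BalabanUVNodes» (K4 «SpineRates»), node N15 = NE2 — THE `V′₁` KNIT: `T4EtaRate.NE2PlusOperator` BY NAME for the U = 1 vector single-scale piece ⊗ 1_𝔤
# DRESSED BY THE PRINT's OWN `V′₁(A)` OF (3.52) — all three terms, BOTH bond orientations — with EVERY U ≡ 1 input, forward AND backward, a tree theorem

Cell `pub-ymgap`, seat `pub-ymgap-dag-n15-c` (generation g3; R134 ACCELERATION SEAT, strategy s1; HUMAN RULING D-0062; chair R424 venue; `bears_on: R4∕N15`).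
Filed `--supports stmt-QuantumFields-19908 --as helper` (K3′ «SpineGivenEndpointR12»; helper).  THEOREMS ONLY; imports BY NAME, nothing in the tree modified:
this seat's `…N15VectorPieceBackward` (`uniform_layer_backward`: the five backward `U ≡ 1` families), `…N15BackwardShift` §4 (`dPieces`, `mPieces`,
`v1VecInstance`, `v1VecFamily4`), M4 `…N15VectorPieceBackgroundMatrix` (`tensorId`, `hasMaj_tensorId`, `idef_tensorId`, `uniform_layer_firstOrderM`: the twelve
forward families ⊗ 1_𝔤), V2 `…N15BackgroundV1ByName` (**`ne2PlusOperator_v1`**), n15-a's carrier lineage (`unitTorusGeoS`, `thetaV`, `VecIndexS`, `blkFine`,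
`kingPrV`, `inv_pow_le_rpow`, `B6UnitTorusCarrier`).

WHAT THIS IS (g2 HANDOFF «LOCATED (V3)»).  V2 proved `NE2PlusOperator` BY NAME for ANY family whose only displayed hypotheses are the `U ≡ 1` layer on the
product carrier `X × ι` with derived pieces indexed by the FORWARD∕BACKWARD STACK `J ⊕ J` — the print's `V′₁(A) = M_c + Σ_μ[M_{a⁺_μ}∇⁺_μ + M_{a⁻_μ}∇⁻_μ]`
([B9] (3.52) p.400) needs both bond orientations.  The honest inhabitant is the U = 1 vector single-scale piece `G = H_k·C^{(k)}·(η^{d+1}H_kᵀ)` ⊗ 1_𝔤 with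
`inl μ ↦ ∂_μG ⊗ 1`, `inr μ ↦ ∇⁻_μG ⊗ 1 = S_{−μ}∂_μG ⊗ 1` (`dPieces`), mixed sources `mPieces`, entry-1 direction `inl j.ν`.  §1 assembles the `U ≡ 1` layer on the
stack at ONE `(β, δ, m₀)`: forward half = M4's `uniform_layer_firstOrderM`, backward half = `uniform_layer_backward` lifted by `hasMaj_tensorId` ∕ `idef_tensorId`;
§2 is ONE `exact ne2PlusOperator_v1 …`, plus the NE2⁰ corollary at the carrier's `one = (0, 0, 0)`.

CONTENTS.
* §1 **`uniform_layer_v1M`**: the twelve hypothesis families of `ne2PlusOperator_v1` at the realised pieces (derived ∕ mixed pieces on `Fin (d+1) ⊕ Fin (d+1)`),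
  one `(β, δ, m₀)`, every sized index.
* §2 **`ne2PlusOperator_vectorPiece_v1`**: for `d + 1 ≥ 2`, `L ≥ 1`, `𝔄` a complete normed real algebra with coordinates `e : 𝔄 ≃L[ℝ] ℝ^ι` and every `c₃₅ > 0`,
  `T4EtaRate.NE2PlusOperator c₃₅ (v1VecInstance 𝔄 ι L hL) (v1VecFamily4 𝔄 ι e L hL)`; `_dim4`; `ne2ZeroOperator_vectorPiece_v1` (`_dim4`).

HONEST FRAMING ∕ LIMITS.  A knit: no estimate beyond the cited modules.  What the statement covers: the LINEAR (U = 1) vector piece of [B5]∕[B6]∕King (4.42) ⊗ 1_𝔤,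
dressed by the print's first-order species `V′₁(A)` with the three coefficient fields `(A⁺, A⁻, W)` transported INDEPENDENTLY by fibrewise means (linearised
(C3)), `F′_{1,k}` of (3.52) and `V′₂` of (3.55)–(3.62) NOT included, one single-scale piece — NOT NODE 00's multiscale carrier, NOT the (C3) nonlinear transport.
NE2⁺ proper NOT PRINTED as a theorem of [B9]; count-neutral (typed 28∕28 · discharged unchanged); NOT a discharge of N15; one finite T⁴ at fixed ε — NOT
infinite volume, NOT OS on ℝ⁴, NOT a mass gap, NOT Clay.
-/

noncomputable section

open scoped BigOperators
open Finset

namespace Summit.QuantumFields.YangMills.BalabanUVNodes.N15.VectorPiece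

open Literature.MathematicalPhysics.QuantumFieldTheory.Balaban1983to89
open Literature.MathematicalPhysics.QuantumFieldTheory.Balaban1983to89.B11SectG (BlockNorm HasMaj RowSum)
open Literature.MathematicalPhysics.QuantumFieldTheory.Balaban1983to89.B6RandomWalk (Triangle254)
open Literature.MathematicalPhysics.QuantumFieldTheory.Balaban1983to89.T4EtaRate (PairedInstance NE2PlusOperator NE2ZeroOperator ne2Zero_of_ne2Plus)
open Literature.MathematicalPhysics.QuantumFieldTheory.Balaban1983to89.T4EtaRateDefect (idef rateWeight)
open Literature.MathematicalPhysics.QuantumFieldTheory.Balaban1983to89.T4EtaRateCoeffDefect (pull)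
open Literature.MathematicalPhysics.QuantumFieldTheory.Balaban1983to89.B5Prop11Plancherel (Tor fine)
open Literature.MathematicalPhysics.QuantumFieldTheory.Balaban1983to89.B6UnitTorusCarrier (unitTorusGeo unitTorusGeo_len triangle254_unitTorusGeo
  rowSum_unitTorusGeo)
open Literature.MathematicalPhysics.QuantumFieldTheory.King1986.Torus (tdistT tdistT_nonneg)
open Summit.QuantumFields.YangMills.BalabanUVNodes.N15.MatrixSpecies (liftMap liftBlk)
open Summit.QuantumFields.YangMills.BalabanUVNodes.N15.BackgroundLayer (ne2PlusOperator_v1)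

variable {d : ℕ}

/-! ## §1 The U ≡ 1 layer on the forward∕backward stack, tensored with `1_𝔤`, at ONE uniform `(β, δ, m₀)` -/

section Layer

variable {ι : Type} [Fintype ι] {L : ℕ} [NeZero L]

/-- **THE UNIFORM U ≡ 1 LAYER ON THE FORWARD∕BACKWARD STACK ⊗ 1_𝔤.**  For `d + 1 ≥ 2`, `L ≥ 1` there are `β, δ, m₀ > 0` such that at every sized index `j` the
twelve hypothesis families of `ne2PlusOperator_v1` hold for the lifted pieces — `G`, `G′`, `G∂_ν*`, `(Δ′−∂′∂′*)G′`, the derived pieces `dPieces` (`∂_μG` AND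
`∇⁻_μG`, coarse and fine) and mixed pieces `mPieces` (coarse), with the five η-defects at `m₀·θ_j·e^{−δd}`: the forward half is M4's `uniform_layer_firstOrderM`,
the backward half `uniform_layer_backward` lifted by `hasMaj_tensorId` ∕ `idef_tensorId`. [cite: King1986, (4.42)–(4.43) p.675 (mechanism); Balaban1985BackgroundPropagators, (3.42) p.397, (3.44) p.398, (3.52) p.400 (shapes)] -/
theorem uniform_layer_v1M (hd : 1 ≤ d) (hL : 1 ≤ L) :
    ∃ β δ m₀ : ℝ, 0 < β ∧ 0 < δ ∧ 0 < m₀ ∧ ∀ j : VecIndexS d L,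
      HasMaj (BlockNorm.ofBlocks (unitTorusGeoS L j.k j.Mn j.Msz) (liftBlk (blkFine L j.k j.Mn) ι))
          (BlockNorm.ofBlocks (unitTorusGeoS L j.k j.Mn j.Msz) (liftBlk (blkFine L j.k j.Mn) ι))
          (tensorId ι (pieceG L j.Mn (L ^ j.k) j.k (rweight (d := d) L j.k)))
          (fun y y' => β * Real.exp (-(δ * (unitTorusGeoS L j.k j.Mn j.Msz).dist y y')))
      ∧ (∀ μ, HasMaj (BlockNorm.ofBlocks (unitTorusGeoS L j.k j.Mn j.Msz) (liftBlk (blkFine L j.k j.Mn) ι))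
          (BlockNorm.ofBlocks (unitTorusGeoS L j.k j.Mn j.Msz) (liftBlk (blkFine L j.k j.Mn) ι))
          (tensorId ι (dPieces L j.Mn (L ^ j.k) j.k (rweight (d := d) L j.k) μ))
          (fun y y' => β * Real.exp (-(δ * (unitTorusGeoS L j.k j.Mn j.Msz).dist y y'))))
      ∧ HasMaj (BlockNorm.ofBlocks (unitTorusGeoS L j.k j.Mn j.Msz) (liftBlk (blkFine L j.k j.Mn ∘ kingPrV L j.k j.m j.Mn) ι))
          (BlockNorm.ofBlocks (unitTorusGeoS L j.k j.Mn j.Msz) (liftBlk (blkFine L j.k j.Mn ∘ kingPrV L j.k j.m j.Mn) ι))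
          (tensorId ι (pieceG L j.Mn (L ^ j.m * L ^ j.k) (j.k + j.m) (rweight (d := d) L j.k / ((L : ℝ) ^ j.m) ^ (d + 1))))
          (fun y y' => β * Real.exp (-(δ * (unitTorusGeoS L j.k j.Mn j.Msz).dist y y')))
      ∧ (∀ μ, HasMaj (BlockNorm.ofBlocks (unitTorusGeoS L j.k j.Mn j.Msz) (liftBlk (blkFine L j.k j.Mn ∘ kingPrV L j.k j.m j.Mn) ι))
          (BlockNorm.ofBlocks (unitTorusGeoS L j.k j.Mn j.Msz) (liftBlk (blkFine L j.k j.Mn ∘ kingPrV L j.k j.m j.Mn) ι))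
          (tensorId ι (dPieces L j.Mn (L ^ j.m * L ^ j.k) (j.k + j.m) (rweight (d := d) L j.k / ((L : ℝ) ^ j.m) ^ (d + 1)) μ))
          (fun y y' => β * Real.exp (-(δ * (unitTorusGeoS L j.k j.Mn j.Msz).dist y y'))))
      ∧ HasMaj (BlockNorm.ofBlocks (unitTorusGeoS L j.k j.Mn j.Msz) (liftBlk (blkFine L j.k j.Mn) ι))
          (BlockNorm.ofBlocks (unitTorusGeoS L j.k j.Mn j.Msz) (liftBlk (blkFine L j.k j.Mn) ι))
          (tensorId ι (pieceS L j.Mn (L ^ j.k) j.k (rweight (d := d) L j.k) j.ν))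
          (fun y y' => β * Real.exp (-(δ * (unitTorusGeoS L j.k j.Mn j.Msz).dist y y')))
      ∧ (∀ μ, HasMaj (BlockNorm.ofBlocks (unitTorusGeoS L j.k j.Mn j.Msz) (liftBlk (blkFine L j.k j.Mn) ι))
          (BlockNorm.ofBlocks (unitTorusGeoS L j.k j.Mn j.Msz) (liftBlk (blkFine L j.k j.Mn) ι))
          (tensorId ι (mPieces L j.Mn (L ^ j.k) j.k (rweight (d := d) L j.k) j.ν μ))
          (fun y y' => β * Real.exp (-(δ * (unitTorusGeoS L j.k j.Mn j.Msz).dist y y'))))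
      ∧ HasMaj (BlockNorm.ofBlocks (unitTorusGeoS L j.k j.Mn j.Msz) (liftBlk (blkFine L j.k j.Mn ∘ kingPrV L j.k j.m j.Mn) ι))
          (BlockNorm.ofBlocks (unitTorusGeoS L j.k j.Mn j.Msz) (liftBlk (blkFine L j.k j.Mn ∘ kingPrV L j.k j.m j.Mn) ι))
          (tensorId ι (pieceD3 L j.Mn (L ^ j.m * L ^ j.k) (j.k + j.m) (rweight (d := d) L j.k / ((L : ℝ) ^ j.m) ^ (d + 1))))
          (fun y y' => β * Real.exp (-(δ * (unitTorusGeoS L j.k j.Mn j.Msz).dist y y')))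
      ∧ HasMaj (BlockNorm.ofBlocks (unitTorusGeoS L j.k j.Mn j.Msz) (liftBlk (blkFine L j.k j.Mn) ι))
          (BlockNorm.ofBlocks (unitTorusGeoS L j.k j.Mn j.Msz) (liftBlk (blkFine L j.k j.Mn ∘ kingPrV L j.k j.m j.Mn) ι))
          (idef (pull (liftMap (kingPrV L j.k j.m j.Mn) ι)) (pull (liftMap (kingPrV L j.k j.m j.Mn) ι))
            (tensorId ι (pieceG L j.Mn (L ^ j.m * L ^ j.k) (j.k + j.m) (rweight (d := d) L j.k / ((L : ℝ) ^ j.m) ^ (d + 1))))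
            (tensorId ι (pieceG L j.Mn (L ^ j.k) j.k (rweight (d := d) L j.k))))
          (fun y y' => m₀ * thetaV L j * Real.exp (-(δ * (unitTorusGeoS L j.k j.Mn j.Msz).dist y y')))
      ∧ (∀ μ, HasMaj (BlockNorm.ofBlocks (unitTorusGeoS L j.k j.Mn j.Msz) (liftBlk (blkFine L j.k j.Mn) ι))
          (BlockNorm.ofBlocks (unitTorusGeoS L j.k j.Mn j.Msz) (liftBlk (blkFine L j.k j.Mn ∘ kingPrV L j.k j.m j.Mn) ι))
          (idef (pull (liftMap (kingPrV L j.k j.m j.Mn) ι)) (pull (liftMap (kingPrV L j.k j.m j.Mn) ι))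
            (tensorId ι (dPieces L j.Mn (L ^ j.m * L ^ j.k) (j.k + j.m) (rweight (d := d) L j.k / ((L : ℝ) ^ j.m) ^ (d + 1)) μ))
            (tensorId ι (dPieces L j.Mn (L ^ j.k) j.k (rweight (d := d) L j.k) μ)))
          (fun y y' => m₀ * thetaV L j * Real.exp (-(δ * (unitTorusGeoS L j.k j.Mn j.Msz).dist y y'))))
      ∧ HasMaj (BlockNorm.ofBlocks (unitTorusGeoS L j.k j.Mn j.Msz) (liftBlk (blkFine L j.k j.Mn) ι))
          (BlockNorm.ofBlocks (unitTorusGeoS L j.k j.Mn j.Msz) (liftBlk (blkFine L j.k j.Mn ∘ kingPrV L j.k j.m j.Mn) ι))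
          (idef (pull (liftMap (kingPrV L j.k j.m j.Mn) ι)) (pull (liftMap (kingPrV L j.k j.m j.Mn) ι))
            (tensorId ι (pieceS L j.Mn (L ^ j.m * L ^ j.k) (j.k + j.m) (rweight (d := d) L j.k / ((L : ℝ) ^ j.m) ^ (d + 1)) j.ν))
            (tensorId ι (pieceS L j.Mn (L ^ j.k) j.k (rweight (d := d) L j.k) j.ν)))
          (fun y y' => m₀ * thetaV L j * Real.exp (-(δ * (unitTorusGeoS L j.k j.Mn j.Msz).dist y y')))
      ∧ (∀ μ, HasMaj (BlockNorm.ofBlocks (unitTorusGeoS L j.k j.Mn j.Msz) (liftBlk (blkFine L j.k j.Mn) ι))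
          (BlockNorm.ofBlocks (unitTorusGeoS L j.k j.Mn j.Msz) (liftBlk (blkFine L j.k j.Mn ∘ kingPrV L j.k j.m j.Mn) ι))
          (idef (pull (liftMap (kingPrV L j.k j.m j.Mn) ι)) (pull (liftMap (kingPrV L j.k j.m j.Mn) ι))
            (tensorId ι (mPieces L j.Mn (L ^ j.m * L ^ j.k) (j.k + j.m) (rweight (d := d) L j.k / ((L : ℝ) ^ j.m) ^ (d + 1)) j.ν μ))
            (tensorId ι (mPieces L j.Mn (L ^ j.k) j.k (rweight (d := d) L j.k) j.ν μ)))
          (fun y y' => m₀ * thetaV L j * Real.exp (-(δ * (unitTorusGeoS L j.k j.Mn j.Msz).dist y y'))))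
      ∧ HasMaj (BlockNorm.ofBlocks (unitTorusGeoS L j.k j.Mn j.Msz) (liftBlk (blkFine L j.k j.Mn) ι))
          (BlockNorm.ofBlocks (unitTorusGeoS L j.k j.Mn j.Msz) (liftBlk (blkFine L j.k j.Mn ∘ kingPrV L j.k j.m j.Mn) ι))
          (idef (pull (liftMap (kingPrV L j.k j.m j.Mn) ι)) (pull (liftMap (kingPrV L j.k j.m j.Mn) ι))
            (tensorId ι (pieceD3 L j.Mn (L ^ j.m * L ^ j.k) (j.k + j.m) (rweight (d := d) L j.k / ((L : ℝ) ^ j.m) ^ (d + 1))))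
            (tensorId ι (pieceD3 L j.Mn (L ^ j.k) j.k (rweight (d := d) L j.k))))
          (fun y y' => m₀ * thetaV L j * Real.exp (-(δ * (unitTorusGeoS L j.k j.Mn j.Msz).dist y y'))) := by
  obtain ⟨β₁, δ₁, m₁, hβ₁, hδ₁, hm₁, HF⟩ := uniform_layer_firstOrderM (d := d) (ι := ι) (L := L) hd hL
  obtain ⟨β₂, δ₂, m₂, hβ₂, hδ₂, hm₂, HB⟩ := uniform_layer_backward (d := d) (L := L) hd hL
  set β : ℝ := max β₁ β₂ with hβ
  set δ : ℝ := min δ₁ δ₂ with hδ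
  set m₀ : ℝ := max m₁ m₂ with hm₀
  refine ⟨β, δ, m₀, lt_max_of_lt_left hβ₁, lt_min hδ₁ hδ₂, lt_max_of_lt_left hm₁, fun j => ?_⟩
  obtain ⟨hG, hD, hG', hD', hS, hSD, hD3', hDG, hDD, hDS, hDSD, hDD3⟩ := HF j
  obtain ⟨bD, bD', bSD, bDD, bDSD⟩ := HB j
  have hx0 : (0 : ℝ) < (L : ℝ) ^ j.k := pow_pos (by exact_mod_cast (show 0 < L by omega)) _
  have hθ0 : 0 ≤ thetaV L j := Real.rpow_nonneg hx0.le _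
  -- weakening to the common letters (`β_i ≤ β`, `m_i ≤ m₀`, `δ ≤ δ_i`)
  have hplain : ∀ {β' δ' : ℝ}, 0 ≤ β' → β' ≤ β → δ ≤ δ' → ∀ y y' : Tor j.Mn,
      β' * Real.exp (-(δ' * tdistT j.Mn y y')) ≤ β * Real.exp (-(δ * tdistT j.Mn y y')) := fun hβ' hββ hδδ y y' =>
    mul_le_mul hββ (Real.exp_le_exp.mpr (neg_le_neg (mul_le_mul_of_nonneg_right hδδ (tdistT_nonneg _ _ _)))) (Real.exp_nonneg _)
      (hβ'.trans hββ)
  have hdef : ∀ {m' δ' : ℝ}, 0 ≤ m' → m' ≤ m₀ → δ ≤ δ' → ∀ y y' : Tor j.Mn,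
      m' * thetaV L j * Real.exp (-(δ' * tdistT j.Mn y y')) ≤ m₀ * thetaV L j * Real.exp (-(δ * tdistT j.Mn y y')) := fun hm' hmm hδδ y y' =>
    mul_le_mul (mul_le_mul_of_nonneg_right hmm hθ0)
      (Real.exp_le_exp.mpr (neg_le_neg (mul_le_mul_of_nonneg_right hδδ (tdistT_nonneg _ _ _)))) (Real.exp_nonneg _)
      (mul_nonneg (hm'.trans hmm) hθ0)
  have hβ₁β : β₁ ≤ β := le_max_left _ _
  have hβ₂β : β₂ ≤ β := le_max_right _ _
  have hm₁m : m₁ ≤ m₀ := le_max_left _ _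
  have hm₂m : m₂ ≤ m₀ := le_max_right _ _
  have hδ₁' : δ ≤ δ₁ := min_le_left _ _
  have hδ₂' : δ ≤ δ₂ := min_le_right _ _
  -- nonnegativity of the backward letters (for the `tensorId` lift)
  have hβ₂e : ∀ y y' : (unitTorusGeoS L j.k j.Mn j.Msz).Site, 0 ≤ β₂ * Real.exp (-(δ₂ * (unitTorusGeoS L j.k j.Mn j.Msz).dist y y')) :=
    fun _ _ => mul_nonneg hβ₂.le (Real.exp_nonneg _)
  have hm₂e : ∀ y y' : (unitTorusGeoS L j.k j.Mn j.Msz).Site, 0 ≤ m₂ * thetaV L j * Real.exp (-(δ₂ * (unitTorusGeoS L j.k j.Mn j.Msz).dist y y')) :=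
    fun _ _ => mul_nonneg (mul_nonneg hm₂.le hθ0) (Real.exp_nonneg _)
  refine ⟨hG.mono (hplain hβ₁.le hβ₁β hδ₁'), ?_, hG'.mono (hplain hβ₁.le hβ₁β hδ₁'), ?_, hS.mono (hplain hβ₁.le hβ₁β hδ₁'), ?_,
    hD3'.mono (hplain hβ₁.le hβ₁β hδ₁'), hDG.mono (hdef hm₁.le hm₁m hδ₁'), ?_, hDS.mono (hdef hm₁.le hm₁m hδ₁'), ?_,
    hDD3.mono (hdef hm₁.le hm₁m hδ₁')⟩
  · rintro (μ | μ)
    · exact (hD μ).mono (hplain hβ₁.le hβ₁β hδ₁')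
    · exact (hasMaj_tensorId ι hβ₂e (bD μ)).mono (hplain hβ₂.le hβ₂β hδ₂')
  · rintro (μ | μ)
    · exact (hD' μ).mono (hplain hβ₁.le hβ₁β hδ₁')
    · exact (hasMaj_tensorId ι hβ₂e (bD' μ)).mono (hplain hβ₂.le hβ₂β hδ₂')
  · rintro (μ | μ)
    · exact (hSD μ).mono (hplain hβ₁.le hβ₁β hδ₁')
    · exact (hasMaj_tensorId ι hβ₂e (bSD μ)).mono (hplain hβ₂.le hβ₂β hδ₂')
  · rintro (μ | μ)
    · exact (hDD μ).mono (hdef hm₁.le hm₁m hδ₁')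
    · rw [show dPieces L j.Mn (L ^ j.m * L ^ j.k) (j.k + j.m) (rweight (d := d) L j.k / ((L : ℝ) ^ j.m) ^ (d + 1)) (Sum.inr μ) =
          pieceD1b L j.Mn (L ^ j.m * L ^ j.k) (j.k + j.m) (rweight (d := d) L j.k / ((L : ℝ) ^ j.m) ^ (d + 1)) μ from rfl,
        show dPieces L j.Mn (L ^ j.k) j.k (rweight (d := d) L j.k) (Sum.inr μ) = pieceD1b L j.Mn (L ^ j.k) j.k (rweight (d := d) L j.k) μ from rfl,
        idef_tensorId]
      exact (hasMaj_tensorId ι hm₂e (bDD μ)).mono (hdef hm₂.le hm₂m hδ₂')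
  · rintro (μ | μ)
    · exact (hDSD μ).mono (hdef hm₁.le hm₁m hδ₁')
    · rw [show mPieces L j.Mn (L ^ j.m * L ^ j.k) (j.k + j.m) (rweight (d := d) L j.k / ((L : ℝ) ^ j.m) ^ (d + 1)) j.ν (Sum.inr μ) =
          pieceMb L j.Mn (L ^ j.m * L ^ j.k) (j.k + j.m) (rweight (d := d) L j.k / ((L : ℝ) ^ j.m) ^ (d + 1)) μ j.ν from rfl,
        show mPieces L j.Mn (L ^ j.k) j.k (rweight (d := d) L j.k) j.ν (Sum.inr μ) = pieceMb L j.Mn (L ^ j.k) j.k (rweight (d := d) L j.k) μ j.ν from rfl,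
        idef_tensorId]
      exact (hasMaj_tensorId ι hm₂e (bDSD μ)).mono (hdef hm₂.le hm₂m hδ₂')

end Layer

/-! ## §2 THE KNIT: `NE2PlusOperator` BY NAME with the print's own `V′₁(A)` live, every U ≡ 1 input a tree theorem -/

section Knit

variable {𝔄 : Type} [NormedRing 𝔄] [NormedAlgebra ℝ 𝔄] [CompleteSpace 𝔄] {ι : Type} [Fintype ι] [DecidableEq ι] (e : 𝔄 ≃L[ℝ] (ι → ℝ)) {L : ℕ} [NeZero L]

/-- **NE2⁺, OPERATOR LAYER — THE NODE's FIRST CONJUNCT `T4EtaRate.NE2PlusOperator` BY NAME FOR THE U = 1 VECTOR SINGLE-SCALE PIECE `G ⊗ 1_𝔤` DRESSED BY THE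
PRINT's OWN `V′₁(A)` OF (3.52)** — `V′₁ = M_c + Σ_μ[M_{a⁺_μ}∇⁺_μ + M_{a⁻_μ}∇⁻_μ]`, `c = ad_W + Σ_μ[F′(ad A⁺_μ) + F′(ad A⁻_μ)]`, `a^±_μ = ad A^±_μ ± ηF′(ad A^±_μ)` in the
coordinates `e`, all three terms and BOTH bond orientations: the realised family over the `V′₁` carriers (configurations `(A⁺, A⁻, W)`, (3.35) CONSUMED on each in
the norm of `𝔄`, transport = fibrewise means), size guard LIVE (`v1VecInstance_gf_M`, unbounded `M`), M1's pair and all four (3.42) entries CONSTRUCTED over the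
forward∕backward stack, and EVERY U ≡ 1 input — the twelve hypothesis families of V2's `ne2PlusOperator_v1` including the BACKWARD derived and mixed pieces — a
landed theorem (§1; rate number `θ_j = (L^k)^{−¼} ≥ η = L^{−k}`, `η ≤ 1`).  V2 instantiated. [cite: Balaban1985BackgroundPropagators, Thm 3.1 p.397 (quantifier template), (3.35) p.396, (3.42) p.397, (3.44) p.398, (3.50)–(3.52) p.400, (3.63)–(3.65) pp.402–403 (shapes, mechanism); King1986, (4.42)–(4.43) p.675; Balaban1984PropagatorsII, (2.156) p.250] -/
theorem ne2PlusOperator_vectorPiece_v1 (hd : 1 ≤ d) (hL : 1 ≤ L) (c35 : ℝ) (hc35 : 0 < c35) :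
    NE2PlusOperator c35 (v1VecInstance (d := d) 𝔄 ι L hL) (v1VecFamily4 (d := d) 𝔄 ι e L hL) := by
  obtain ⟨β, δ, m₀, hβ, hδ, hm₀, H⟩ := uniform_layer_v1M (d := d) (ι := ι) (L := L) hd hL
  have hL0 : L ≠ 0 := by omega
  have hLr : (0 : ℝ) < (L : ℝ) := by exact_mod_cast (show 0 < L by omega)
  have hL1 : (1 : ℝ) ≤ (L : ℝ) := by exact_mod_cast hL
  have hσ : 0 < δ / 2 := half_pos hδ
  exact ne2PlusOperator_v1 e (I := VecIndexS d L) (J := Fin (d + 1)) (fun j => unitTorusGeoS L j.k j.Mn j.Msz)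
    (fun j => Tor (fine (L ^ j.k) j.Mn) × Fin (d + 1)) (fun j => Tor (fine (L ^ j.m * L ^ j.k) j.Mn) × Fin (d + 1))
    (fun j => blkFine L j.k j.Mn) (fun j => kingPrV L j.k j.m j.Mn) (fun j => j.m) (fun j => unitTorusGeoS_L_ne_zero L hL j) (thetaV L) (thetaV L)
    (fun j => Sum.inl j.ν)
    (fun j => tensorId ι (pieceG L j.Mn (L ^ j.k) j.k (rweight (d := d) L j.k)))
    (fun j => tensorId ι (pieceS L j.Mn (L ^ j.k) j.k (rweight (d := d) L j.k) j.ν))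
    (fun j => tensorId ι (pieceD3 L j.Mn (L ^ j.k) j.k (rweight (d := d) L j.k)))
    (fun j μ => tensorId ι (dPieces L j.Mn (L ^ j.k) j.k (rweight (d := d) L j.k) μ))
    (fun j μ => tensorId ι (mPieces L j.Mn (L ^ j.k) j.k (rweight (d := d) L j.k) j.ν μ))
    (fun j => tensorId ι (pieceG L j.Mn (L ^ j.m * L ^ j.k) (j.k + j.m) (rweight (d := d) L j.k / ((L : ℝ) ^ j.m) ^ (d + 1))))
    (fun j => tensorId ι (pieceS L j.Mn (L ^ j.m * L ^ j.k) (j.k + j.m) (rweight (d := d) L j.k / ((L : ℝ) ^ j.m) ^ (d + 1)) j.ν))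
    (fun j => tensorId ι (pieceD3 L j.Mn (L ^ j.m * L ^ j.k) (j.k + j.m) (rweight (d := d) L j.k / ((L : ℝ) ^ j.m) ^ (d + 1))))
    (fun j μ => tensorId ι (dPieces L j.Mn (L ^ j.m * L ^ j.k) (j.k + j.m) (rweight (d := d) L j.k / ((L : ℝ) ^ j.m) ^ (d + 1)) μ))
    (fun j μ => tensorId ι (mPieces L j.Mn (L ^ j.m * L ^ j.k) (j.k + j.m) (rweight (d := d) L j.k / ((L : ℝ) ^ j.m) ^ (d + 1)) j.ν μ))
    c35 hc35 (fun j => triangle254_unitTorusGeo L j.k j.Mn) (fun j a b => tdistT_nonneg _ _ _) hσ.le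
    (B4Sect5Proof.latticeConst_nonneg (d + 1) hσ.le) (fun j => rowSum_unitTorusGeo L j.k j.Mn hσ)
    (fun j => inv_pos.mpr (pow_pos hLr _)) (fun j => inv_le_one_of_one_le₀ (one_le_pow₀ hL1)) (fun j => inv_pow_le_rpow hL j.k (by norm_num))
    (fun j => hL1) (fun j y => (unitTorusGeo_len L j.k j.Mn hL0 y).symm.le)
    (by linarith) hβ.le hm₀.le (by norm_num : (0 : ℝ) < 1 / 4) (fun j y => le_rfl)
    (fun j => (H j).1) (fun j => (H j).2.1) (fun j => (H j).2.2.1) (fun j => (H j).2.2.2.1) (fun j => (H j).2.2.2.2.1)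
    (fun j => (H j).2.2.2.2.2.1) (fun j => (H j).2.2.2.2.2.2.1) (fun j => (H j).2.2.2.2.2.2.2.1) (fun j => (H j).2.2.2.2.2.2.2.2.1)
    (fun j => (H j).2.2.2.2.2.2.2.2.2.1) (fun j => (H j).2.2.2.2.2.2.2.2.2.2.1) (fun j => (H j).2.2.2.2.2.2.2.2.2.2.2)

/-- The four-dimensional instance (`d + 1 = 4`; e.g. `𝔄 = M₂(ℂ)` as a real algebra carrying `𝔤 = su(2)`, `ι` indexing a real basis).
[cite: Balaban1985BackgroundPropagators, Thm 3.1 p.397 (quantifier template)] -/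
theorem ne2PlusOperator_vectorPiece_v1_dim4 (hL : 1 ≤ L) (c35 : ℝ) (hc35 : 0 < c35) :
    NE2PlusOperator c35 (v1VecInstance (d := 3) 𝔄 ι L hL) (v1VecFamily4 (d := 3) 𝔄 ι e L hL) :=
  ne2PlusOperator_vectorPiece_v1 (d := 3) e (by norm_num) hL c35 hc35

/-- **NE2⁰ FOR THE SAME FAMILY — the node's fourth decl `T4EtaRate.NE2ZeroOperator` BY NAME**: at the trivial configuration `(A⁺, A⁻, W) = 0` (the carrier's
`one`; (3.35) holds there for every `α₀ > 0` since `M ≥ 1`, `θ_j ≥ 0`) the η-difference family obeys `EtaRateIneq342` — `T4EtaRate.ne2Zero_of_ne2Plus` at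
`c₃₅ = 1`. [cite: King1986, Props. 3.8–3.9 (3.71)–(3.75) pp.664–665 (A = 0 model); Balaban1985BackgroundPropagators, Thm 3.1 p.397 (quantifier template)] -/
theorem ne2ZeroOperator_vectorPiece_v1 (hd : 1 ≤ d) (hL : 1 ≤ L) :
    NE2ZeroOperator (v1VecInstance (d := d) 𝔄 ι L hL) (v1VecFamily4 (d := d) 𝔄 ι e L hL) := by
  refine ne2Zero_of_ne2Plus (c35 := 1) (fun j α₀ hα₀ => ?_) (ne2PlusOperator_vectorPiece_v1 (d := d) e hd hL 1 one_pos)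
  have hM : 0 ≤ (1 : ℝ) * j.Msz * α₀ := by
    have h1 : (0 : ℝ) ≤ j.Msz := zero_le_one.trans j.one_le_Msz
    positivity
  have hθ : 0 ≤ thetaV L j := Real.rpow_nonneg (pow_nonneg (Nat.cast_nonneg L) _) _
  have hMθ : 0 ≤ (1 : ℝ) * j.Msz * α₀ * thetaV L j := mul_nonneg hM hθ
  refine ⟨⟨fun μ x' => ?_, fun μ x' => ?_, fun x' => ?_⟩, ⟨fun μ x₁' x₂' _ => ?_, fun μ x₁' x₂' _ => ?_, fun x₁' x₂' _ => ?_⟩⟩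
  · show ‖(0 : 𝔄)‖ ≤ 1 * j.Msz * α₀
    rw [norm_zero]; exact hM
  · show ‖(0 : 𝔄)‖ ≤ 1 * j.Msz * α₀
    rw [norm_zero]; exact hM
  · show ‖(0 : 𝔄)‖ ≤ 1 * j.Msz * α₀
    rw [norm_zero]; exact hM
  · show ‖(0 : 𝔄) - 0‖ ≤ 1 * j.Msz * α₀ * thetaV L j
    rw [sub_zero, norm_zero]; exact hMθ
  · show ‖(0 : 𝔄) - 0‖ ≤ 1 * j.Msz * α₀ * thetaV L j
    rw [sub_zero, norm_zero]; exact hMθ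
  · show ‖(0 : 𝔄) - 0‖ ≤ 1 * j.Msz * α₀ * thetaV L j
    rw [sub_zero, norm_zero]; exact hMθ

/-- The four-dimensional instance of the NE2⁰ corollary. [cite: King1986, Props. 3.8–3.9 (3.71)–(3.75) pp.664–665 (A = 0 model)] -/
theorem ne2ZeroOperator_vectorPiece_v1_dim4 (hL : 1 ≤ L) :
    NE2ZeroOperator (v1VecInstance (d := 3) 𝔄 ι L hL) (v1VecFamily4 (d := 3) 𝔄 ι e L hL) :=
  ne2ZeroOperator_vectorPiece_v1 (d := 3) e (by norm_num) hL

end Knit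

end Summit.QuantumFields.YangMills.BalabanUVNodes.N15.VectorPiece

end
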